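import Summits.AnomalousDissipation.AnomalousDissipation.Theorems.MarginalStabilityChainChainRealisationStubConvectWordEstimate
import Summits.AnomalousDissipation.AnomalousDissipation.Theorems.MarginalStabilityChainChainRealisationStubSobolevBootstrap
import Summits.AnomalousDissipation.AnomalousDissipation.Theorems.MarginalStabilityChainChainRealisationStubLiftBounds
import Summits.AnomalousDissipation.AnomalousDissipation.Theorems.MarginalStabilityChainChainRealisationStubAscoliSmooth
import Summits.AnomalousDissipation.AnomalousDissipation.Theorems.MarginalStabilityChainChainRealisationStubCompactLimitsOfShifts
import Summits.AnomalousDissipation.AnomalousDissipation.Theorems.MarginalStabilityChainChainRealisationStubPhaseOfCompactLimits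
import Summits.AnomalousDissipation.AnomalousDissipation.Theorems.MarginalStabilityChainChainRealisationEternalisation
import HarnessLib

/-!
# The forward Navier–Stokes phase at fixed viscosity, and the line `SketchIdeator2` reduced to its residual
# (crux stmt-AnomalousDissipation-14249, `MarginalStabilityChain.ChainRealisation`)

Sorry-free ASSEMBLY of the six landed stubs B1–B6 of line lead -1's reshape of `stub_forwardPhaseH2`
(`stub_convectWordEstimate`, `stub_sobolevBootstrap`, `stub_liftBounds`, `stub_ascoliSmooth`,
`stub_compactLimitsOfShifts`, `stub_phaseOfCompactLimits`) with the landed conditional glue of the line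
(`…Theorems.MarginalStabilityChainChainRealisationEternalisation`):

* `forwardPhaseH2_holds` — **THE FORWARD PHASE** (the statement of lead -0's stub `stub_forwardPhaseH2`, now a
  theorem): at fixed `ν > 0` and for a steady smooth solenoidal mean-zero force, every forward classical solution on
  `[0,∞) × T³` with mean-zero slices, enstrophy bounded on `t ≥ 0` and `‖Δu(t)‖₂²` bounded on `t ≥ 1` lives in an
  NS PHASE `(K, φ)` (`IsNSPhase`: compact forward-invariant set of smooth states in `H` with a jointly continuous
  semiflow of global classical solutions and `L²`-continuous enstrophy) through `u`.  Proof: all-order Sobolev bounds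
  (B2∘B1: word-level `H^m` energy method + uniform Gronwall above the landed `H²` rung) ⇒ bounded space–time
  derivatives of the lifts (B3) ⇒ compact limits of time-translates (B5: Arzelà–Ascoli B4, limits of classical
  solutions are classical) ⇒ the phase (B6: uniqueness + metric compactness).
  (Foias–Manley–Rosa–Temam 2001 Ch. III §2; Constantin–Foias 1988 Ch. 13–14.)
* `forwardPhase_holds` — the same with the `H²` hypothesis removed (landed absorbing bound `stub_laplacianSupBound`).
* `eternalisationZM_holds` — **ETERNALISATION AT ONE VISCOSITY (mean-zero class), UNCONDITIONAL**: a forward classical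
  mean-zero solution with bounded enstrophy, limsup-mean energy `≤ E` and limsup-mean dissipation `≥ ε > 0` yields an
  ETERNAL classical solution of the same system with dissipation `≥ ε/2` and energy `≤ 16‖f‖₂² max(E,1)²/ε²`
  (crux 3005's lemma `EternalisationAt` in the mean-zero class; Krylov–Bogoliubov + generic points + backward orbits,
  all landed by lead -0, fed by the phase).
* `chainThesis_of_forwardFamilyZM_holds` — `ChainThesis` (crux 3005, the route target) from ANY forward-regular loud
  bounded mean-zero family for ONE smooth solenoidal mean-zero force.
* `chainRealisation_of_contrastFamily` — **THE LINE AS ONE THEOREM WITH ONLY ITS RESIDUAL**: the crux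
  `ChainRealisation` from the contrast family (`ContrastFamily` of the skeleton, written out), i.e. from the
  zeroth-law content of the crux in the card's Eulerian mean-field form for the arena force `twoHalf g (μ • h)`.

No new definitions; no named facts; every statement is a theorem.
-/

set_option linter.dupNamespace false

noncomputable section

open MeasureTheory Set Filter Topology
open scoped InnerProductSpace
open Literature.Analysis.FunctionSpaces Literature.Analysis.FunctionSpaces.Torus
open Literature.Analysis.FluidPDE Literature.Analysis.FluidPDE.Torus

namespace Summit.AnomalousDissipation.AnomalousDissipation.Theorems.ChainRealisation.SeparatrixFluxPinning

open Summit.AnomalousDissipation.AnomalousDissipation.Theorems.DenseLoudDesignerForces.Ergodic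
open Summit.AnomalousDissipation.AnomalousDissipation.Theses.MarginalStabilityChain

/-- **THE FORWARD PHASE ABOVE THE `H²` RUNG** (statement of `stub_forwardPhaseH2`, assembled from the landed stubs
B1–B6: all-order bounds ⇒ lift bounds ⇒ compact limits of translates ⇒ phase). -/
theorem forwardPhaseH2_holds :
    ∀ (ν : ℝ) (F : UnitAddTorus (Fin 3) → EuclideanSpace ℝ (Fin 3))
      (u : ℝ → UnitAddTorus (Fin 3) → EuclideanSpace ℝ (Fin 3)) (p : ℝ → UnitAddTorus (Fin 3) → ℝ),
      0 < ν → IsSmooth F → IsDivFree F → HasZeroMean F →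
      IsClassicalNSSolutionOn (Set.Ici 0) ν (fun _ => F) u p →
      (∃ M : ℝ, ∀ t : ℝ, 0 ≤ t → gradNormSq (u t) ≤ M) →
      (∀ t : ℝ, 0 ≤ t → HasZeroMean (u t)) →
      (∃ M₂ : ℝ, ∀ t : ℝ, 1 ≤ t → ∫ x, ‖laplacian (u t) x‖ ^ 2 ≤ M₂) →
      ∃ (K : Set Hsp) (φ : ℝ → Hsp → Hsp) (x₀ : Hsp), IsNSPhase ν F K φ ∧ x₀ ∈ K ∧
        ∀ t : ℝ, 0 ≤ t → rep (φ t x₀) =ᵐ[volume] u t := by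
  intro ν F u p hν hF hdiv hmean hsol hM hzm hM2
  have hall : ∀ k : ℕ, ∃ C : ℝ, ∀ t : ℝ, 0 ≤ t → sobolevEnergy k (u t) ≤ C :=
    stub_sobolevBootstrap stub_convectWordEstimate ν F u p hν hF hsol hzm hM hM2
  have hcomp := stub_compactLimitsOfShifts stub_liftBounds stub_ascoliSmooth ν F u p hν hF hdiv hmean hsol hzm hall
  exact stub_phaseOfCompactLimits ν F u p hν.le hsol hzm hcomp

/-- **THE FORWARD PHASE**: at fixed `ν > 0`, for a steady smooth solenoidal mean-zero force, every forward classical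
solution on `[0,∞) × T³` with mean-zero slices and enstrophy bounded on `t ≥ 0` lives in an NS phase through `u`
(the `H²` hypothesis of `forwardPhaseH2_holds` is discharged by the landed absorbing bound `stub_laplacianSupBound`). -/
theorem forwardPhase_holds :
    ∀ (ν : ℝ) (F : UnitAddTorus (Fin 3) → EuclideanSpace ℝ (Fin 3))
      (u : ℝ → UnitAddTorus (Fin 3) → EuclideanSpace ℝ (Fin 3)) (p : ℝ → UnitAddTorus (Fin 3) → ℝ),
      0 < ν → IsSmooth F → IsDivFree F → HasZeroMean F →
      IsClassicalNSSolutionOn (Set.Ici 0) ν (fun _ => F) u p →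
      (∃ M : ℝ, ∀ t : ℝ, 0 ≤ t → gradNormSq (u t) ≤ M) →
      (∀ t : ℝ, 0 ≤ t → HasZeroMean (u t)) →
      ∃ (K : Set Hsp) (φ : ℝ → Hsp → Hsp) (x₀ : Hsp), IsNSPhase ν F K φ ∧ x₀ ∈ K ∧
        ∀ t : ℝ, 0 ≤ t → rep (φ t x₀) =ᵐ[volume] u t :=
  forwardPhase_of_forwardPhaseH2 forwardPhaseH2_holds

/-- **ETERNALISATION AT ONE VISCOSITY, MEAN-ZERO CLASS (unconditional).**  A forward classical mean-zero solution
with bounded enstrophy, limsup-mean energy `≤ E` and limsup-mean dissipation `≥ ε > 0` (steady smooth solenoidal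
mean-zero force, `ν > 0`) yields an ETERNAL classical solution of the same system with dissipation `≥ ε/2` and energy
`≤ 16‖f‖₂²·max(E,1)²/ε²`. -/
theorem eternalisationZM_holds :
    ∀ (ν : ℝ) (f : UnitAddTorus (Fin 3) → EuclideanSpace ℝ (Fin 3)),
      0 < ν → IsSmooth f → IsDivFree f → HasZeroMean f →
      ∀ (u : ℝ → UnitAddTorus (Fin 3) → EuclideanSpace ℝ (Fin 3)) (p : ℝ → UnitAddTorus (Fin 3) → ℝ) (E ε : ℝ),
        IsClassicalNSSolutionOn (Set.Ici 0) ν (fun _ => f) u p →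
        (∃ M : ℝ, ∀ t : ℝ, 0 ≤ t → gradNormSq (u t) ≤ M) →
        (∀ t : ℝ, 0 ≤ t → HasZeroMean (u t)) →
        meanEnergy u ≤ E → 0 < ε → ε ≤ meanDissipation ν u →
        ∃ (v : ℝ → UnitAddTorus (Fin 3) → EuclideanSpace ℝ (Fin 3)) (q : ℝ → UnitAddTorus (Fin 3) → ℝ),
          IsClassicalNSSolutionOn Set.univ ν (fun _ => f) v q ∧
          meanEnergy v ≤ 16 * (∫ x, ‖f x‖ ^ 2) * (max E 1) ^ 2 / ε ^ 2 ∧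
          ε / 2 ≤ meanDissipation ν v :=
  fun _ _ hν hf hdiv hmean u p E ε hsol hM hzm hE hε hεD =>
    eternalisationZM_of_forwardPhaseH2 forwardPhaseH2_holds hν hf hdiv hmean u p E ε hsol hM hzm hE hε hεD

/-- **`ChainThesis` (the route target, crux 3005) from a forward-regular loud bounded MEAN-ZERO family for ONE force
(unconditional).**  For a steady smooth solenoidal mean-zero `f`: `ν_j → 0`, forward classical solutions on
`[0,∞) × T³` with mean-zero slices and (per-`j`) bounded enstrophy, limsup-mean energy `≤ E`, limsup-mean dissipation
`≥ ε > 0` ⇒ `ChainThesis`. -/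
theorem chainThesis_of_forwardFamilyZM_holds {f : UnitAddTorus (Fin 3) → EuclideanSpace ℝ (Fin 3)}
    (hf : IsSmooth f) (hdiv : IsDivFree f) (hmean : HasZeroMean f)
    (hC : ∃ (ν : ℕ → ℝ) (u : ℕ → ℝ → UnitAddTorus (Fin 3) → EuclideanSpace ℝ (Fin 3))
        (p : ℕ → ℝ → UnitAddTorus (Fin 3) → ℝ),
      (∀ j, 0 < ν j) ∧ Tendsto ν atTop (nhds 0) ∧
      (∀ j, IsClassicalNSSolutionOn (Set.Ici 0) (ν j) (fun _ => f) (u j) (p j)) ∧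
      (∀ j, ∃ M : ℝ, ∀ t : ℝ, 0 ≤ t → gradNormSq (u j t) ≤ M) ∧
      (∀ j t, 0 ≤ t → HasZeroMean (u j t)) ∧
      (∃ E : ℝ, ∀ j, meanEnergy (u j) ≤ E) ∧
      ∃ ε : ℝ, 0 < ε ∧ ∀ j, ε ≤ meanDissipation (ν j) (u j)) :
    ChainThesis :=
  chainThesis_of_forwardPhaseH2 forwardPhaseH2_holds hf hdiv hmean hC

/-- **THE LINE AS ONE THEOREM WITH ONLY ITS RESIDUAL.**  The crux `ChainRealisation` follows from the contrast family
(the skeleton's `ContrastFamily`, written out): a smooth planar solenoidal mean-free `g`, a smooth mean-free axial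
pattern `h`, `μ > 0`, `a₀ > 0`, `E`, and along some `ν_j → 0` forward classical mean-zero regular solutions for the
arena force `twoHalf g (μ • h)` with limsup-mean energy `≤ E`, non-negative mean planar work and the `ν`-uniform axial
contrast floor `a₀`.  (Budget step + eternalisation + generic points, all landed; the forward phase above.) -/
theorem chainRealisation_of_contrastFamily
    (hCF : ∃ (g : UnitAddTorus (Fin 2) → EuclideanSpace ℝ (Fin 2)) (h : UnitAddTorus (Fin 2) → ℝ) (μ a₀ E : ℝ),
      IsSmooth g ∧ IsDivFree g ∧ HasZeroMean g ∧ IsSmooth h ∧ HasZeroMean h ∧ 0 < μ ∧ 0 < a₀ ∧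
      ∃ (ν : ℕ → ℝ) (u : ℕ → ℝ → UnitAddTorus (Fin 3) → EuclideanSpace ℝ (Fin 3))
        (p : ℕ → ℝ → UnitAddTorus (Fin 3) → ℝ),
        (∀ j, 0 < ν j) ∧ Tendsto ν atTop (nhds 0) ∧
        (∀ j, IsClassicalNSSolutionOn (Set.Ici 0) (ν j) (fun _ => twoHalf g (μ • h)) (u j) (p j)) ∧
        (∀ j, ∃ M : ℝ, ∀ t : ℝ, 0 ≤ t → gradNormSq (u j t) ≤ M) ∧
        (∀ j t, 0 ≤ t → HasZeroMean (u j t)) ∧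
        (∀ j, meanEnergy (u j) ≤ E) ∧
        (∀ j, 0 ≤ longTimeAvgInf (fun t => ∫ x, ⟪g (planarProj x), planarProjE (u j t x)⟫_ℝ)) ∧
        (∀ j, a₀ ≤ longTimeAvgSup (fun t => ∫ x, h (planarProj x) * u j t x 2))) :
    ChainRealisation :=
  chainRealisation_of_forwardPhaseH2_of_contrastFamily forwardPhaseH2_holds hCF

end Summit.AnomalousDissipation.AnomalousDissipation.Theorems.ChainRealisation.SeparatrixFluxPinning

end
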